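import Mathlib
import HarnessLib
import Literature.MathematicalPhysics.QuantumLattice.GaugeGroups
import Literature.MathematicalPhysics.QuantumFieldTheory.ConstructiveQFTWave0
import Literature.MathematicalPhysics.QuantumFieldTheory.LatticeGaugeProofs
import Summits.Ventures.LatticeQCDFlow.Scaling.FluxTunnellingU1ExplicitLaw

/-!
# LatticeQCDFlow / Scaling — the EXPLICIT sector-autocorrelation floor for exact link-by-link samplers of 2-d `U(1)`

HONEST FRAMING: exact (Metropolis-corrected) sampling algorithms for lattice gauge theory; figures of merit are
autocorrelation/cost numbers at stated couplings and volumes; no continuum-physics claim.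

Venture `LatticeQCDFlow` (cell pub-lqcd), topic `Scaling`, FANOUT row 30 (lean-1) — OUR WORK, file 7 of the explicit
`U(1)` tunnelling programme: the figure of merit itself.  Theory-2's `Tunnelling.sectorAutocov_ge`
(`Scaling/TunnellingLaws.lean`) turns a per-step sector-change budget `m` into a floor `a(1 − a) − n·m` under the
lag-`n` autocovariance of any sector indicator of stationary mass `a`; `Scaling/FluxTunnellingU1ExplicitLaw.lean`
gives the budget explicitly.  Here, for the 2-d Wilson measure `μ_{β,L}` of `U(1)`, `L` EVEN, `β ≥ 0`:

* `u1_measureReal_linkPatch_le` — the per-link thick-plaquette tail as a real number: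
  `μ_{β,L}{S_P ≥ 2} ≤ e^{−2β}/z₁(β)³`;
* **`u1_sector_autocov_floor`** — for ANY process `Z₀, Z₁, …` with one-time marginals `μ_{β,L}` whose `k`-th step a.s.
  changes only one link (every exact link-by-link sampler in equilibrium: heat bath, Metropolis, proposal + filter,
  in any systematic order), every set `S` of charges and every lag `n`:
  `Cov(1_S(Q(Z_0)), 1_S(Q(Z_n))) ≥ a(1 − a) − n · 2e^{−2β}/z₁(β)³`, `a = μ_{β,L}{Q ∈ S}`;
* **`u1_sector_return_floor`** — `P{Q(Z_0) ∈ S ∧ Q(Z_n) ∈ S} ≥ a − n·2e^{−2β}/z₁(β)³`.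

Reading (value-free): with `z₁(β) ≥ e^{−1/2}/(π√β)` (`inv_sqrt_le_z1`) the normalised autocorrelation of every sector
indicator at lag `n` is at least `1 − n·2π³e^{3/2}β^{3/2}e^{−2β}/(a(1−a))`: the integrated autocorrelation time of the
topological sector of ANY exact single-link chain is `≳ a(1−a)·e^{2β}/(280·β^{3/2})` link updates, uniformly in the
(even) volume.  The sector mass `a` is NOT bounded here (it is a property of `μ_{β,L}`, `≍` Gaussian in `Q` of width
`∝ L/√β`).  Elementary given files 1–5; nothing is cited as a fact; no `def`.
-/

noncomputable section

namespace Summit.Ventures.LatticeQCDFlow.Theory2.Lattice.TwoDim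

open MeasureTheory ProbabilityTheory Literature.MathematicalPhysics.QuantumFieldTheory
open Literature.MathematicalPhysics.QuantumLattice (u1Rep u1Rep_apply continuous_u1Rep)
open Summit.Ventures.LatticeQCDFlow.Theory2.Lattice.Flux
open scoped ENNReal

variable {L : ℕ}

/-- `z₁(β)` is a positive finite number: `0 < z₁(β).toReal` (`β ≥ 0`). [folklore] -/
theorem z1_toReal_pos {β : ℝ} (hβ : 0 ≤ β) : 0 < (z1 u1Rep β).toReal := by
  refine ENNReal.toReal_pos ?_ (ne_top_of_le_ne_top ENNReal.one_ne_top (z1_le_one u1Rep U1.re_trace_u1Rep_le hβ))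
  intro h
  have := exp_neg_two_mul_le_z1 hβ
  rw [h, nonpos_iff_eq_zero, ENNReal.ofReal_eq_zero] at this
  exact absurd this (not_le.mpr (Real.exp_pos _))

/-- **The per-link thick-plaquette tail in real numbers**: `μ_{β,L}{S_P ≥ #P(1 − cos(π/#P))} ≤ e^{−2β}/z₁(β)³`
for the plane positions `P` touched by the link `e₀` (`L` even, `β ≥ 0`). [folklore] -/
theorem u1_measureReal_linkPatch_le [NeZero L] (hL : 2 ≤ L) (hLe : Even L) {β : ℝ} (hβ : 0 ≤ β)
    (x₀ : Site 2 L) (e₀ : Edge 2 L) :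
    (wilsonMeasure (d := 2) (L := L) u1Rep β).real
        {U | ((Finset.univ.filter fun p : ZMod L × ZMod L => e₀ ∈ plaqLinks (planeSite x₀ 0 1 p) 0 1).card : ℝ) *
            (1 - Real.cos (Real.pi /
              (Finset.univ.filter fun p : ZMod L × ZMod L => e₀ ∈ plaqLinks (planeSite x₀ 0 1 p) 0 1).card)) ≤
          patchAction x₀ 0 1
            (Finset.univ.filter fun p : ZMod L × ZMod L => e₀ ∈ plaqLinks (planeSite x₀ 0 1 p) 0 1) U} ≤
      Real.exp (-(2 * β)) / (z1 u1Rep β).toReal ^ 3 := by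
  classical
  set T : Set (GaugeConfig 2 L Circle) :=
    {U | ((Finset.univ.filter fun p : ZMod L × ZMod L => e₀ ∈ plaqLinks (planeSite x₀ 0 1 p) 0 1).card : ℝ) *
        (1 - Real.cos (Real.pi /
          (Finset.univ.filter fun p : ZMod L × ZMod L => e₀ ∈ plaqLinks (planeSite x₀ 0 1 p) 0 1).card)) ≤
      patchAction x₀ 0 1
        (Finset.univ.filter fun p : ZMod L × ZMod L => e₀ ∈ plaqLinks (planeSite x₀ 0 1 p) 0 1) U} with hT
  have h : z1 u1Rep β ^ 3 * wilsonMeasure (d := 2) (L := L) u1Rep β T ≤ ENNReal.ofReal (Real.exp (-(2 * β))) :=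
    u1_pow_three_mul_measure_linkPatch_le hL hLe hβ x₀ e₀
  have hz := z1_toReal_pos hβ
  have hzt : z1 u1Rep β ≠ ⊤ :=
    ne_top_of_le_ne_top ENNReal.one_ne_top (z1_le_one u1Rep U1.re_trace_u1Rep_le hβ)
  haveI : IsProbabilityMeasure (wilsonMeasure (d := 2) (L := L) u1Rep β) :=
    isProbabilityMeasure_wilsonMeasure u1Rep continuous_u1Rep β
  rw [le_div_iff₀ (pow_pos hz 3), mul_comm, measureReal_def, ← ENNReal.toReal_pow, ← ENNReal.toReal_mul]
  have hne : z1 u1Rep β ^ 3 * wilsonMeasure (d := 2) (L := L) u1Rep β T ≠ ⊤ :=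
    ENNReal.mul_ne_top (ENNReal.pow_ne_top hzt) (measure_ne_top _ _)
  calc (z1 u1Rep β ^ 3 * wilsonMeasure (d := 2) (L := L) u1Rep β T).toReal
      ≤ (ENNReal.ofReal (Real.exp (-(2 * β)))).toReal := (ENNReal.toReal_le_toReal hne ENNReal.ofReal_ne_top).mpr h
    _ = Real.exp (-(2 * β)) := ENNReal.toReal_ofReal (Real.exp_pos _).le

/-- **THE EXPLICIT SECTOR-AUTOCORRELATION FLOOR** (2-d `U(1)`, `L` even, `β ≥ 0`).  For any process `Z` with all
one-time marginals `μ_{β,L}` whose `k`-th step a.s. changes only the link `e k`, every set `S ⊆ ℝ` of charges and every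
lag `n`, with `a := P{Q(Z_0) ∈ S} = P{Q(Z_n) ∈ S}`:
`a(1 − a) − n·2e^{−2β}/z₁(β)³ ≤ P{Q(Z_0) ∈ S ∧ Q(Z_n) ∈ S} − P{Q(Z_0) ∈ S}·P{Q(Z_n) ∈ S}`. [folklore] -/
theorem u1_sector_autocov_floor [NeZero L] (hL : 2 ≤ L) (hLe : Even L) {β : ℝ} (hβ : 0 ≤ β)
    (x₀ : Site 2 L) {Ω : Type*} [MeasurableSpace Ω] (P : Measure Ω) [IsProbabilityMeasure P]
    (Z : ℕ → Ω → GaugeConfig 2 L Circle) (hZ : ∀ k, Measurable (Z k))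
    (hmarg : ∀ k, P.map (Z k) = wilsonMeasure (d := 2) (L := L) u1Rep β)
    (e : ℕ → Edge 2 L) (hloc : ∀ k, ∀ᵐ ω ∂P, ∀ e', e' ≠ e k → Z k ω e' = Z (k + 1) ω e')
    (S : Set ℝ) (n : ℕ) {a : ℝ} (h0 : P.real {ω | Flux.topCharge x₀ 0 1 (Z 0 ω) ∈ S} = a)
    (hn : P.real {ω | Flux.topCharge x₀ 0 1 (Z n ω) ∈ S} = a) :
    a * (1 - a) - n * (2 * (Real.exp (-(2 * β)) / (z1 u1Rep β).toReal ^ 3)) ≤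
      P.real {ω | Flux.topCharge x₀ 0 1 (Z 0 ω) ∈ S ∧ Flux.topCharge x₀ 0 1 (Z n ω) ∈ S} -
        P.real {ω | Flux.topCharge x₀ 0 1 (Z 0 ω) ∈ S} * P.real {ω | Flux.topCharge x₀ 0 1 (Z n ω) ∈ S} := by
  classical
  set μW := wilsonMeasure (d := 2) (L := L) u1Rep β with hμW
  haveI : IsProbabilityMeasure μW := isProbabilityMeasure_wilsonMeasure u1Rep continuous_u1Rep β
  let Pk : ℕ → Finset (ZMod L × ZMod L) := fun k =>
    Finset.univ.filter fun p => e k ∈ plaqLinks (planeSite x₀ 0 1 p) 0 1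
  let B : ℕ → Set (GaugeConfig 2 L Circle) := fun k =>
    {U | ((Pk k).card : ℝ) * (1 - Real.cos (Real.pi / (Pk k).card)) ≤ patchAction x₀ 0 1 (Pk k) U}
  have hPne : ∀ k, (Pk k).Nonempty := by
    intro k
    refine ⟨(((e k).1 - x₀) 0, ((e k).1 - x₀) 1), Finset.mem_filter.mpr ⟨Finset.mem_univ _, ?_⟩⟩
    rw [(planeSite_eq_iff x₀ (e k).1 _).mpr rfl]
    obtain ⟨y, i⟩ := e k
    fin_cases i <;> simp [plaqLinks]
  have hP : ∀ k p, (∃ e' ∈ plaqLinks (planeSite x₀ 0 1 p) 0 1, e' ∈ ({e k} : Finset (Edge 2 L))) → p ∈ Pk k := by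
    rintro k p ⟨e', he', he0⟩
    rw [Finset.mem_singleton] at he0
    subst he0
    exact Finset.mem_filter.mpr ⟨Finset.mem_univ _, he'⟩
  have hB : ∀ k ⦃U U' : GaugeConfig 2 L Circle⦄, (∀ e', e' ≠ e k → U e' = U' e') →
      Flux.topCharge x₀ 0 1 U ≠ Flux.topCharge x₀ 0 1 U' → U ∈ B k ∨ U' ∈ B k := by
    intro k U U' hUU' hQ
    have hoff := plaquette_eq_off_patch_of_links (hP k) (U := U) (U' := U')
      (fun e' he' => hUU' e' (fun h => he' (Finset.mem_singleton.mpr h)))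
    exact patchAction_ge_sharp_or_of_topCharge_ne x₀ 0 1 (hPne k) hoff hQ
  have hpos : 0 ≤ 2 * (Real.exp (-(2 * β)) / (z1 u1Rep β).toReal ^ 3) := by
    have := z1_toReal_pos hβ; positivity
  have hm : ∀ k, P.real (Z k ⁻¹' B k) + P.real (Z (k + 1) ⁻¹' B k) ≤
      2 * (Real.exp (-(2 * β)) / (z1 u1Rep β).toReal ^ 3) := by
    intro k
    have hle : ∀ j, P.real (Z j ⁻¹' B k) ≤ Real.exp (-(2 * β)) / (z1 u1Rep β).toReal ^ 3 := by
      intro j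
      refine le_trans ?_ (u1_measureReal_linkPatch_le hL hLe hβ x₀ (e k))
      rw [measureReal_def, measureReal_def, ← hμW, ← hmarg j]
      exact ENNReal.toReal_mono (measure_ne_top _ _) (Measure.le_map_apply (hZ j).aemeasurable _)
    have := hle k; have := hle (k + 1); linarith
  exact Tunnelling.sectorAutocov_ge (R := fun k (U U' : GaugeConfig 2 L Circle) => ∀ e', e' ≠ e k → U e' = U' e')
    (Q := Flux.topCharge x₀ 0 1) (B := B) hB P Z hloc hpos hm S n h0 hn

/-- **THE EXPLICIT SECTOR-RETURN FLOOR**: `P{Q(Z_0) ∈ S ∧ Q(Z_n) ∈ S} ≥ P{Q(Z_0) ∈ S} − n·2e^{−2β}/z₁(β)³` for the same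
processes — the charge is where it started, up to an explicit `n·e^{−2β}` budget. [folklore] -/
theorem u1_sector_return_floor [NeZero L] (hL : 2 ≤ L) (hLe : Even L) {β : ℝ} (hβ : 0 ≤ β)
    (x₀ : Site 2 L) {Ω : Type*} [MeasurableSpace Ω] (P : Measure Ω) [IsProbabilityMeasure P]
    (Z : ℕ → Ω → GaugeConfig 2 L Circle) (hZ : ∀ k, Measurable (Z k))
    (hmarg : ∀ k, P.map (Z k) = wilsonMeasure (d := 2) (L := L) u1Rep β)
    (e : ℕ → Edge 2 L) (hloc : ∀ k, ∀ᵐ ω ∂P, ∀ e', e' ≠ e k → Z k ω e' = Z (k + 1) ω e')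
    (S : Set ℝ) (n : ℕ) :
    P.real {ω | Flux.topCharge x₀ 0 1 (Z 0 ω) ∈ S} - n * (2 * (Real.exp (-(2 * β)) / (z1 u1Rep β).toReal ^ 3)) ≤
      P.real {ω | Flux.topCharge x₀ 0 1 (Z 0 ω) ∈ S ∧ Flux.topCharge x₀ 0 1 (Z n ω) ∈ S} := by
  classical
  set μW := wilsonMeasure (d := 2) (L := L) u1Rep β with hμW
  haveI : IsProbabilityMeasure μW := isProbabilityMeasure_wilsonMeasure u1Rep continuous_u1Rep β
  let Pk : ℕ → Finset (ZMod L × ZMod L) := fun k =>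
    Finset.univ.filter fun p => e k ∈ plaqLinks (planeSite x₀ 0 1 p) 0 1
  let B : ℕ → Set (GaugeConfig 2 L Circle) := fun k =>
    {U | ((Pk k).card : ℝ) * (1 - Real.cos (Real.pi / (Pk k).card)) ≤ patchAction x₀ 0 1 (Pk k) U}
  have hPne : ∀ k, (Pk k).Nonempty := by
    intro k
    refine ⟨(((e k).1 - x₀) 0, ((e k).1 - x₀) 1), Finset.mem_filter.mpr ⟨Finset.mem_univ _, ?_⟩⟩
    rw [(planeSite_eq_iff x₀ (e k).1 _).mpr rfl]
    obtain ⟨y, i⟩ := e k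
    fin_cases i <;> simp [plaqLinks]
  have hP : ∀ k p, (∃ e' ∈ plaqLinks (planeSite x₀ 0 1 p) 0 1, e' ∈ ({e k} : Finset (Edge 2 L))) → p ∈ Pk k := by
    rintro k p ⟨e', he', he0⟩
    rw [Finset.mem_singleton] at he0
    subst he0
    exact Finset.mem_filter.mpr ⟨Finset.mem_univ _, he'⟩
  have hB : ∀ k ⦃U U' : GaugeConfig 2 L Circle⦄, (∀ e', e' ≠ e k → U e' = U' e') →
      Flux.topCharge x₀ 0 1 U ≠ Flux.topCharge x₀ 0 1 U' → U ∈ B k ∨ U' ∈ B k := by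
    intro k U U' hUU' hQ
    have hoff := plaquette_eq_off_patch_of_links (hP k) (U := U) (U' := U')
      (fun e' he' => hUU' e' (fun h => he' (Finset.mem_singleton.mpr h)))
    exact patchAction_ge_sharp_or_of_topCharge_ne x₀ 0 1 (hPne k) hoff hQ
  have hpos : 0 ≤ 2 * (Real.exp (-(2 * β)) / (z1 u1Rep β).toReal ^ 3) := by
    have := z1_toReal_pos hβ; positivity
  have hm : ∀ k, P.real (Z k ⁻¹' B k) + P.real (Z (k + 1) ⁻¹' B k) ≤
      2 * (Real.exp (-(2 * β)) / (z1 u1Rep β).toReal ^ 3) := by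
    intro k
    have hle : ∀ j, P.real (Z j ⁻¹' B k) ≤ Real.exp (-(2 * β)) / (z1 u1Rep β).toReal ^ 3 := by
      intro j
      refine le_trans ?_ (u1_measureReal_linkPatch_le hL hLe hβ x₀ (e k))
      rw [measureReal_def, measureReal_def, ← hμW, ← hmarg j]
      exact ENNReal.toReal_mono (measure_ne_top _ _) (Measure.le_map_apply (hZ j).aemeasurable _)
    have := hle k; have := hle (k + 1); linarith
  exact Tunnelling.sectorReturn_ge (R := fun k (U U' : GaugeConfig 2 L Circle) => ∀ e', e' ≠ e k → U e' = U' e')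
    (Q := Flux.topCharge x₀ 0 1) (B := B) hB P Z hloc hpos hm S n

end Summit.Ventures.LatticeQCDFlow.Theory2.Lattice.TwoDim
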